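/-
Copyright: the b2b-balaban T⁴-continuum CRUX team, row NE7b OWNER lineage `t4-ne7b-p1` (gen 129). Project licence.
-/
import Summits.QuantumFields.BalabanUV.T4Continuum.Spine.NE7b.SupEffectiveActionDerivative
import Summits.QuantumFields.BalabanUV.T4Continuum.Spine.NE7b.SupEffectiveActionLocality
import Summits.QuantumFields.BalabanUV.T4Continuum.Spine.NE7b.SupOneSitePerturbation

/-!
# THE GRADIENT OF THE SMALL-FIELD EFFECTIVE ACTION IS `O(ε)` PER SITE, UNIFORMLY IN THE VOLUME: on a region `S` where the external field is
# small on cells, the `y`-partial derivative of `−log ∫e^{−Σ_{p∈S}Σ_{x∈cell p}w_x(ω_x+ψ_x)}dN(0,Γ)` at `ψ₀` — the tilted mean of `w'_y(ω_y+ψ₀,y)`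
# ((313)) — obeys `|∂_y(−log Z_ψ(S))(ψ₀)| ≤ 2·(Δ+1)·2e·ε̃_ΨA_τ^v`, `ε̃_Ψ = max(e^{v(c₃h³+c₂h²)}−1, 2e^{−(κ∕2−κ₀−c₂)h²})·e^{½κ(1+τ⁻¹)Ψ²}`: by the
# Gibbs inequality ((314)) the tilted mean is squeezed between two free-energy differences of ROAD-SHAPED integrands whose remainder is
# perturbed at the single site `y` (`w_y ∓ w'_y`, still stable and sup-small), and (311)'s locality bounds each by the clusters pinned at ONE
# cell — the first Taylor coefficient of the next potential is small (row NE7b, node U5c; (313) + (314) + (311) + (306) BY NAME; [folklore])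

Cell `pub-balaban`, sub-cell `t4`, spine estimate NE7b (`T4WeightBudget.RelWeightBound`; the cell's OWN estimate — NOT PRINTED in
[Bałaban 1983–89], NOT PROVED).  Crux-route work under `Spine/NE7b/` by the row OWNER (`t4-ne7b-p1` gen 129, file (315)) under FREEZE
(0)'s crux-prover clause, on § [NE7bP1-G128-HANDOFF] NEXT (3)(c) (the Taylor structure of the next potential: its FIRST coefficient is
`O(ε)`); NOTHING of Bałaban's is named as a Lean object, valued or asserted; no `T4Continuum/Support` leaf typed; no `def`, no notation;
zero `sorry`.  Imports (BY NAME): the OWNER's (313) `…SupEffectiveActionDerivative` (`fderiv_neg_log_step_apply`, `hasFDerivAt_neg_log_step`,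
`mul_opBound_le_of_le`), (314) `…SupOneSitePerturbation` (`abs_tilted_mean_le`, `supSmall_factor_norm_le`, `supSmall_eps_nonneg`, `cubic_supSmall`,
`oneSite_measurable`, `oneSite_stable`, `oneSite_supSmall`, `oneSite_cellSum`), (311) `…SupEffectiveActionLocality`
(`act_norm_pertLogZ_sub_le_of_agree`, `re_eq_log_of_exp_eq`), (306) (`shifted_exp_pertLogZ_on`, `pertZ_road_shift_eq`, `measurable_cellSum`,
`cellSum_eq_sum_biUnion`), (296) (`pertLogZ_cutoff`, `cellActivity_cutoff_of_subset`, `cutoff_shifted_regulated`), (290) (`road_factor_measurable`),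
(289) (`norm_cellActivity_le_of_regulated`), (297) (`integrable_exp_neg`); the tree's `symm_of_inst`; Mathlib's `PiLp.single_apply`,
`Finset.sum_ite_eq'`, `HasFDerivAt.fderiv`.

WHY (located).  (313) gave the gradient as a tilted mean with no size information; the next step of the iteration needs it SMALL (the
background of the next scale is sought near the old one).  Gibbs + one-site perturbation + locality give it per site, with no volume
factor: the honest price is the stronger class (`|w'_x(t)| ≤ c₂t²` besides `≤ κ₁|t|` — both hold for the road's third-order Taylor
remainder with `u″` bounded and Lipschitz) and a regulator dominating `κ₀ + c₂`.

WHAT IS PROVED ([folklore]; `μ = N(0,Γ)` on `ι → ℝ`, `Γ ⪰ 0` of range `ρ`, `Γ ⪯ γ_op·1`, diagonal `≤ γ`; cells pairwise disjoint of `≤ v`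
sites; `R` symmetric covering `ρ`-closeness with `≤ Δ` neighbours; `w_x ∈ C¹` with `w'_x` measurable, `−κ₀t² ≤ w_x(t)`, `|w_x(t)| ≤ c₃|t|³` on
`|t| ≤ h`, `|w'_x(t)| ≤ κ₁|t|`, `|w'_x(t)| ≤ c₂t²` (`c₂ > 0`); `2(κ₀+c₂) ≤ κ`, `κ(1+τ)γ_op ≤ θ < 1`; `ψ₀` small on the cells of `S`; `y ∈ cell p₀`,
`p₀ ∈ S`; `e·ε̃_ΨA_τ^v(Δ+1)² ≤ 1∕2`):
* §1 the perturbed families `w ∓ 1_{·=y}w'`: `perturbed_regulated` (BOTH `w` and `w ∓ 1_yw'` are regulated with the SAME `ε̃`),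
  `abs_log_perturbed_sub_le` (**`|log∫e^{−Σw̃(ω+ψ₀)} − log∫e^{−Σw(ω+ψ₀)}| ≤ 2·(Δ+1)·2e·ε̃_ΨA_τ^v`** — (311)'s locality for two remainder families
  agreeing off the cell of `y`), `single_cellSum` (`Σ_{p∈S}Σ_{x∈cell p}w'_x(…)(e_y)_x = w'_y(ω_y+ψ₀,y)`);
* §2 THE END **`abs_tilted_mean_deriv_le`** (`|(∫e^{−V}w'_y(ω_y+ψ₀,y)dμ)∕(∫e^{−V}dμ)| ≤ 2(Δ+1)2e·ε̃_ΨA_τ^v`) and **`abs_fderiv_neg_log_step_single_le`**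
  (`|D(−log Z_ψ(S))(ψ₀)(e_y)| ≤ 2·(Δ+1)·2e·ε̃_ΨA_τ^v` — the `y`-partial derivative of the small-field effective action, uniformly in `S`); §3 toy.

HONEST (what this is NOT).  First Taylor coefficient only, at unit perturbation strength (`s = 1`; no optimisation in `s`); the Hessian and the
re-entry of the next potential into the road's class are the successor's; scalar skeleton ((A3), NC-NE7b-α UNRULED); nothing of Bałaban's
asserted.  BY-NAME EFFECT ON THE WALL: NONE.  NE7b NOT PRINTED ∕ NOT PROVED; spine PROVED 0∕9; rung (B)+1 — the programme's measures remain
FINITE-torus statements; NOT the mass gap, NOT Clay.  HONEST DEPENDENCY: continuum YM on T⁴ ⇐ BetaPertH ∧ nine spine estimates (0∕9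
proved); BetaPertH ⇐ (D1) ∧ (D4) ∧ CAP+tail; G-an2-4 gates asym, D1 and NE2∕3∕4.
-/

set_option autoImplicit false

noncomputable section

namespace Summit.QuantumFields.BalabanUV.T4Continuum.NE7b.SupEffectiveActionGradientSmall

open MeasureTheory ProbabilityTheory Finset Real
open scoped BigOperators
open Literature.Probability.LatticeModels (IsRConnected pertZ cellActivity pertLogZ symm_of_inst)
open Literature.Analysis.Matrix (HasFiniteRange)
open SupEffectiveActionDerivative (fderiv_neg_log_step_apply hasFDerivAt_neg_log_step mul_opBound_le_of_le)
open SupOneSitePerturbation (abs_tilted_mean_le supSmall_factor_norm_le supSmall_eps_nonneg cubic_supSmall oneSite_measurable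
  oneSite_stable oneSite_supSmall oneSite_cellSum)
open SupEffectiveActionLocality (act_norm_pertLogZ_sub_le_of_agree re_eq_log_of_exp_eq)
open SupSmallFieldGasReal (shifted_exp_pertLogZ_on pertZ_road_shift_eq measurable_cellSum cellSum_eq_sum_biUnion)
open SupLocalisedPolymerGas (pertLogZ_cutoff cellActivity_cutoff_of_subset cutoff_shifted_regulated)
open SupRoadFactorRegulated (road_factor_measurable)
open SupRegulatedActivityBound (norm_cellActivity_le_of_regulated)
open SupFluctuationAPriori (integrable_exp_neg)

variable {ι : Type} [Fintype ι] [DecidableEq ι] {V : Type*} [DecidableEq V]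

section Main

variable {Γ : Matrix ι ι ℝ} {γop γ : ℝ} {dι : ι → ι → ℕ} {ρ : ℕ} {cell : V → Finset ι} {v : ℕ} {R : V → V → Prop}
  [DecidableRel R] [Std.Symm R] {nbr : V → Finset V} {Δ : ℕ} {w w' : ι → ℝ → ℝ} {κ₀ κ₁ c₂ c₃ h κ τ θ Ψ : ℝ}

/-! ## §1. The perturbed families and the locality of their free energies -/

omit [Fintype ι] [DecidableEq V] [DecidableRel R] [Std.Symm R] in
/-- **Both `w` and its one-site perturbation `w − s·1_yw'` (`|s| ≤ 1`) are regulated with the SAME constant**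
`ε̃ = max(e^{v(c₃h³+c₂h²)}−1, 2e^{−(κ∕2−κ₀−c₂)h²})` (`2(κ₀+c₂) ≤ κ`). [folklore] -/
theorem perturbed_regulated (hv : ∀ p, (cell p).card ≤ v) (hκ₀ : 0 ≤ κ₀) (hc₂ : 0 ≤ c₂) (hc₃ : 0 ≤ c₃) (hh : 0 ≤ h)
    (hstab : ∀ x, ∀ t : ℝ, -(κ₀ * t ^ 2) ≤ w x t) (hcub : ∀ x, ∀ t : ℝ, |t| ≤ h → |w x t| ≤ c₃ * |t| ^ 3)
    (hw'q : ∀ x t, |w' x t| ≤ c₂ * t ^ 2) (hκ : 2 * (κ₀ + c₂) ≤ κ) (y : ι) {s : ℝ} (hs : |s| ≤ 1) (p : V) (ω : EuclideanSpace ℝ ι) :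
    ‖(((exp (-(∑ x ∈ cell p, (w x (ω x) - s * (if x = y then w' x (ω x) else 0)))) - 1 : ℝ)) : ℂ)‖ ≤
      max (exp (v * (c₃ * h ^ 3 + c₂ * h ^ 2)) - 1) (2 * exp (-((κ / 2 - (κ₀ + c₂)) * h ^ 2))) * exp (κ * (∑ x ∈ cell p, ω x ^ 2) / 2) := by
  have hstab' : ∀ x, ∀ t : ℝ, -((κ₀ + c₂) * t ^ 2) ≤ w x t - s * (if x = y then w' x t else 0) := fun x t => by
    have h1 := oneSite_stable w w' y s hstab hw'q x t
    have h2 : 0 ≤ c₂ * (1 - |s|) * t ^ 2 := mul_nonneg (mul_nonneg hc₂ (by linarith)) (sq_nonneg t)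
    nlinarith
  have hsup' : ∀ x, ∀ t : ℝ, |t| ≤ h → |w x t - s * (if x = y then w' x t else 0)| ≤ c₃ * h ^ 3 + c₂ * h ^ 2 := fun x t ht => by
    have h1 := oneSite_supSmall w w' y s hc₃ hc₂ hcub hw'q x t ht
    have h2 : 0 ≤ c₂ * (1 - |s|) * h ^ 2 := mul_nonneg (mul_nonneg hc₂ (by linarith)) (sq_nonneg h)
    nlinarith
  exact supSmall_factor_norm_le cell hv (fun x t => w x t - s * (if x = y then w' x t else 0)) (by positivity) (by positivity) hh
    hstab' hsup' hκ p ω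

/-- **THE FREE ENERGY MOVES BY `O(ε)` UNDER A ONE-SITE PERTURBATION OF THE REMAINDER.**  `Γ ⪰ 0` of range `ρ`, `Γ ⪯ γ_op·1`, diagonal
`≤ γ` (`γ ≥ 0`); disjoint cells of `≤ v` sites; `R` symmetric covering `ρ`-closeness with `≤ Δ` neighbours; measurable `w, w'` with
`−κ₀t² ≤ w`, `|w| ≤ c₃|t|³` on `|t| ≤ h`, `|w'| ≤ c₂t²`; `2(κ₀+c₂) ≤ κ`, `κ(1+τ)γ_op ≤ θ < 1`; `ψ₀` small on the cells of `S`; `y ∈ cell p₀`;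
`|s| ≤ 1`; `e·ε̃_ΨA_τ^v(Δ+1)² ≤ 1∕2` ⟹
`|log ∫e^{−Σ_{p∈S}Σ_{cell p}(w − s1_yw')(ω+ψ₀)}dN(0,Γ) − log ∫e^{−Σ_{p∈S}Σ_{cell p}w(ω+ψ₀)}dN(0,Γ)| ≤ 2·(Δ+1)·2e·ε̃_ΨA_τ^v`. [folklore] -/
theorem abs_log_perturbed_sub_le (hΓ : Γ.PosSemidef) (hΓop : (γop • (1 : Matrix ι ι ℝ) - Γ).PosSemidef) (hdiag : ∀ i, Γ i i ≤ γ)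
    (hγ : 0 ≤ γ) (hfr : HasFiniteRange dι ρ Γ) (hdisj : ∀ p q, p ≠ q → Disjoint (cell p) (cell q)) (hv : ∀ p, (cell p).card ≤ v)
    (hR : ∀ (p p' : V) (x y : ι), x ∈ cell p → y ∈ cell p' → dι x y ≤ ρ → p = p' ∨ R p p')
    (hΔ : ∀ x, (nbr x).card ≤ Δ) (hnbr : ∀ x y, R x y → y ∈ nbr x) (hw : ∀ x, Measurable (w x)) (hw'm : ∀ x, Measurable (w' x))
    (hκ₀ : 0 ≤ κ₀) (hc₂ : 0 ≤ c₂) (hc₃ : 0 ≤ c₃) (hh : 0 ≤ h) (hstab : ∀ x, ∀ t : ℝ, -(κ₀ * t ^ 2) ≤ w x t)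
    (hcub : ∀ x, ∀ t : ℝ, |t| ≤ h → |w x t| ≤ c₃ * |t| ^ 3) (hw'q : ∀ x t, |w' x t| ≤ c₂ * t ^ 2) (hκ : 2 * (κ₀ + c₂) ≤ κ)
    (hτ : 0 < τ) (hθ0 : 0 < θ) (hθ1 : θ < 1) (hκθ : κ * (1 + τ) * γop ≤ θ) (S : Finset V) (ψ₀ : EuclideanSpace ℝ ι)
    (hψ : ∀ p ∈ S, ∑ x ∈ cell p, ψ₀ x ^ 2 ≤ Ψ ^ 2) {p₀ : V} {y : ι} (hy : y ∈ cell p₀) {s : ℝ} (hs : |s| ≤ 1)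
    (hsmall : Real.exp 1 * (((max (exp (v * (c₃ * h ^ 3 + c₂ * h ^ 2)) - 1) (2 * exp (-((κ / 2 - (κ₀ + c₂)) * h ^ 2)))) *
      exp (κ * (1 + τ⁻¹) * Ψ ^ 2 / 2)) * ((1 - θ) ^ (-(κ * (1 + τ) * γ / (2 * θ)))) ^ v) * ((Δ : ℝ) + 1) ^ 2 ≤ 1 / 2) :
    |log (∫ ω : EuclideanSpace ℝ ι, exp (-(∑ p ∈ S, ∑ x ∈ cell p,
        (w x (ω x + ψ₀ x) - s * (if x = y then w' x (ω x + ψ₀ x) else 0)))) ∂(multivariateGaussian 0 Γ)) -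
      log (∫ ω : EuclideanSpace ℝ ι, exp (-(∑ p ∈ S, ∑ x ∈ cell p, w x (ω x + ψ₀ x))) ∂(multivariateGaussian 0 Γ))| ≤
      2 * ((1 : ℝ) * ((Δ : ℝ) + 1) * (2 * (Real.exp 1 * (((max (exp (v * (c₃ * h ^ 3 + c₂ * h ^ 2)) - 1)
        (2 * exp (-((κ / 2 - (κ₀ + c₂)) * h ^ 2)))) * exp (κ * (1 + τ⁻¹) * Ψ ^ 2 / 2)) * ((1 - θ) ^ (-(κ * (1 + τ) * γ / (2 * θ)))) ^ v)))) := by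
  set μ := multivariateGaussian 0 Γ with hμ
  -- the two remainder families, `u 1 = w̃` (perturbed) and `u 0 = w`, handled uniformly through the parameter `r ∈ {s, 0}`
  set wt : ℝ → ι → ℝ → ℝ := fun r x t => w x t - r * (if x = y then w' x t else 0) with hwt
  set ε : ℝ := max (exp (v * (c₃ * h ^ 3 + c₂ * h ^ 2)) - 1) (2 * exp (-((κ / 2 - (κ₀ + c₂)) * h ^ 2))) with hε
  have hε0 : 0 ≤ ε := supSmall_eps_nonneg v _ h κ _
  have hκ' : 0 ≤ κ := by linarith
  have hκτ : 0 ≤ κ * (1 + τ) := mul_nonneg hκ' (by linarith)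
  have h1θ : 0 < 1 - θ := by linarith
  -- the generic facts for `r` with `|r| ≤ 1`
  have hreg : ∀ r : ℝ, |r| ≤ 1 → ∀ p (ω : EuclideanSpace ℝ ι),
      ‖(((exp (-(∑ x ∈ cell p, wt r x (ω x))) - 1 : ℝ)) : ℂ)‖ ≤ ε * exp (κ * (∑ x ∈ cell p, ω x ^ 2) / 2) :=
    fun r hr p ω => perturbed_regulated hv hκ₀ hc₂ hc₃ hh hstab hcub hw'q hκ y hr p ω
  have hmeas : ∀ r : ℝ, ∀ p, Measurable[MeasurableSpace.comap (fun (ω : EuclideanSpace ℝ ι) (x : cell p) => ω x) inferInstance]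
      (fun ω : EuclideanSpace ℝ ι => (((exp (-(∑ x ∈ cell p, wt r x (ω x))) - 1 : ℝ)) : ℂ)) :=
    fun r p => road_factor_measurable cell (wt r) (fun x => oneSite_measurable w w' y r hw hw'm x) p
  -- real logarithm = real part of the KP logarithm, for each family
  have hreal : ∀ r : ℝ, |r| ≤ 1 →
      (pertLogZ μ (fun p ω => (((exp (-(∑ x ∈ cell p, wt r x ((ω + ψ₀) x))) - 1 : ℝ)) : ℂ)) R S).re =
        log (∫ ω : EuclideanSpace ℝ ι, exp (-(∑ p ∈ S, ∑ x ∈ cell p, wt r x (ω x + ψ₀ x))) ∂μ) := by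
    intro r hr
    have hexp := shifted_exp_pertLogZ_on hΓ hΓop hdiag hγ hfr cell hdisj hv hR hΔ hnbr hε0 hκ' hτ hθ0 hθ1 hκθ S
      (g := fun p ω => (((exp (-(∑ x ∈ cell p, wt r x (ω x))) - 1 : ℝ)) : ℂ))
      (fun p _ => hmeas r p) (fun p _ ω => hreg r hr p ω) ψ₀ hψ hsmall
    have hZ := pertZ_road_shift_eq μ cell (wt r) S ψ₀
    rw [hZ] at hexp
    have hne : pertZ μ (fun p ω => (((exp (-(∑ x ∈ cell p, wt r x ((ω + ψ₀) x))) - 1 : ℝ)) : ℂ)) S ≠ 0 := by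
      rw [hZ, ← hexp]; exact Complex.exp_ne_zero _
    have hr0 : 0 ≤ ∫ ω : EuclideanSpace ℝ ι, exp (-(∑ p ∈ S, ∑ x ∈ cell p, wt r x (ω x + ψ₀ x))) ∂μ :=
      integral_nonneg fun ω => (exp_pos _).le
    have hpos : 0 < ∫ ω : EuclideanSpace ℝ ι, exp (-(∑ p ∈ S, ∑ x ∈ cell p, wt r x (ω x + ψ₀ x))) ∂μ := by
      refine lt_of_le_of_ne hr0 fun h0 => hne ?_
      rw [hZ, ← h0, Complex.ofReal_zero]
    exact re_eq_log_of_exp_eq hpos hexp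
  have hs0 : |(0 : ℝ)| ≤ 1 := by rw [abs_zero]; exact zero_le_one
  have hw0 : ∀ x t, wt 0 x t = w x t := fun x t => by simp [hwt]
  -- rewrite both logarithms as real parts
  have hlhs : log (∫ ω : EuclideanSpace ℝ ι, exp (-(∑ p ∈ S, ∑ x ∈ cell p, w x (ω x + ψ₀ x))) ∂μ) =
      (pertLogZ μ (fun p ω => (((exp (-(∑ x ∈ cell p, wt 0 x ((ω + ψ₀) x))) - 1 : ℝ)) : ℂ)) R S).re := by
    rw [hreal 0 hs0]; simp only [hw0]
  rw [show (fun ω : EuclideanSpace ℝ ι => exp (-(∑ p ∈ S, ∑ x ∈ cell p,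
      (w x (ω x + ψ₀ x) - s * (if x = y then w' x (ω x + ψ₀ x) else 0))))) =
      fun ω => exp (-(∑ p ∈ S, ∑ x ∈ cell p, wt s x (ω x + ψ₀ x))) from rfl, ← hreal s hs, hlhs, ← Complex.sub_re]
  refine (Complex.abs_re_le_norm _).trans ?_
  -- localise to `S` and apply the activity-level locality with `D = {p₀}`
  rw [← pertLogZ_cutoff μ (fun p ω => (((exp (-(∑ x ∈ cell p, wt s x ((ω + ψ₀) x))) - 1 : ℝ)) : ℂ)) R S,
    ← pertLogZ_cutoff μ (fun p ω => (((exp (-(∑ x ∈ cell p, wt 0 x ((ω + ψ₀) x))) - 1 : ℝ)) : ℂ)) R S]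
  have hA0 : 0 ≤ (ε * exp (κ * (1 + τ⁻¹) * Ψ ^ 2 / 2)) * ((1 - θ) ^ (-(κ * (1 + τ) * γ / (2 * θ)))) ^ v :=
    mul_nonneg (mul_nonneg hε0 (exp_pos _).le) (pow_nonneg (rpow_pos_of_pos h1θ _).le _)
  have hact : ∀ r : ℝ, |r| ≤ 1 → ∀ K : Finset V, IsRConnected R K →
      ‖cellActivity μ (fun p ω => if p ∈ S then
        (fun p ω => (((exp (-(∑ x ∈ cell p, wt r x (ω x))) - 1 : ℝ)) : ℂ)) p (ω + ψ₀) else 0) K‖ ≤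
        ((ε * exp (κ * (1 + τ⁻¹) * Ψ ^ 2 / 2)) * ((1 - θ) ^ (-(κ * (1 + τ) * γ / (2 * θ)))) ^ v) ^ K.card :=
    fun r hr K _ => norm_cellActivity_le_of_regulated hΓ hΓop hdiag hγ cell hdisj hv (mul_nonneg hε0 (exp_pos _).le) hκτ hθ0 hθ1 hκθ
      (cutoff_shifted_regulated cell hε0 hκ' hτ S (fun p _ ω => hreg r hr p ω) ψ₀ hψ) K
  have key := act_norm_pertLogZ_sub_le_of_agree symm_of_inst hΔ hnbr (hact s hs) (hact 0 hs0) hA0 hsmall S {p₀} (fun K hKS hKD => by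
    rw [cellActivity_cutoff_of_subset μ _ hKS, cellActivity_cutoff_of_subset μ _ hKS]
    -- on cells other than `p₀` the two families coincide pointwise
    unfold cellActivity
    refine integral_congr_ae (ae_of_all _ fun ω => prod_congr rfl fun p hp => ?_)
    have hpp : p ≠ p₀ := fun h0 => Finset.disjoint_left.1 hKD hp (by rw [h0]; exact mem_singleton_self _)
    have hsum : ∑ x ∈ cell p, wt s x ((ω + ψ₀) x) = ∑ x ∈ cell p, wt 0 x ((ω + ψ₀) x) := by
      refine sum_congr rfl fun x hx => ?_
      have hxy : x ≠ y := fun h0 => Finset.disjoint_left.1 (hdisj p p₀ hpp) hx (h0 ▸ hy)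
      simp [hwt, hxy]
    simp only [hsum])
  rw [card_singleton, Nat.cast_one] at key
  exact key

omit [Fintype ι] [DecidableEq V] [DecidableRel R] [Std.Symm R] in
/-- **The base derivative in the direction `e_y` picks the site `y`**: `y ∈ cell p₀`, `p₀ ∈ S`, disjoint cells ⟹
`Σ_{p∈S}Σ_{x∈cell p}w'_x(ω_x+ψ_x)·(e_y)_x = w'_y(ω_y+ψ_y)`. [folklore] -/
theorem single_cellSum (hdisj : ∀ p q, p ≠ q → Disjoint (cell p) (cell q)) (S : Finset V) {p₀ : V} (hp₀ : p₀ ∈ S) {y : ι}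
    (hy : y ∈ cell p₀) (ω ψ : EuclideanSpace ℝ ι) :
    ∑ p ∈ S, ∑ x ∈ cell p, w' x (ω x + ψ x) * (EuclideanSpace.single y (1 : ℝ)) x = w' y (ω y + ψ y) := by
  have hpd : (S : Set V).PairwiseDisjoint cell := fun p _ q _ hpq => hdisj p q hpq
  have hyU : y ∈ S.biUnion cell := mem_biUnion.2 ⟨p₀, hp₀, hy⟩
  simp_rw [EuclideanSpace.single, PiLp.single_apply, mul_ite, mul_one, mul_zero]
  rw [← sum_biUnion hpd, sum_ite_eq' (S.biUnion cell) y, if_pos hyU]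

/-! ## §2. THE END: the gradient is `O(ε)` per site -/

/-- **THE TILTED MEAN OF `w'_y` IS `O(ε)`.**  Hypotheses of `abs_log_perturbed_sub_le` for both signs (`s = ±1`), and `p₀ ∈ S` ⟹
`|(∫ e^{−V(ψ₀,ω)}w'_y(ω_y+ψ₀,y) dN(0,Γ))∕(∫ e^{−V(ψ₀,ω)} dN(0,Γ))| ≤ 2·(Δ+1)·2e·ε̃_ΨA_τ^v` (Gibbs ((314)) + §1). [folklore] -/
theorem abs_tilted_mean_deriv_le (hΓ : Γ.PosSemidef) (hΓop : (γop • (1 : Matrix ι ι ℝ) - Γ).PosSemidef) (hdiag : ∀ i, Γ i i ≤ γ)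
    (hγ : 0 ≤ γ) (hfr : HasFiniteRange dι ρ Γ) (hdisj : ∀ p q, p ≠ q → Disjoint (cell p) (cell q)) (hv : ∀ p, (cell p).card ≤ v)
    (hR : ∀ (p p' : V) (x y : ι), x ∈ cell p → y ∈ cell p' → dι x y ≤ ρ → p = p' ∨ R p p')
    (hΔ : ∀ x, (nbr x).card ≤ Δ) (hnbr : ∀ x y, R x y → y ∈ nbr x) (hw : ∀ x, Measurable (w x)) (hw'm : ∀ x, Measurable (w' x))
    (hκ₀ : 0 ≤ κ₀) (hc₂ : 0 ≤ c₂) (hc₃ : 0 ≤ c₃) (hh : 0 ≤ h) (hstab : ∀ x, ∀ t : ℝ, -(κ₀ * t ^ 2) ≤ w x t)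
    (hcub : ∀ x, ∀ t : ℝ, |t| ≤ h → |w x t| ≤ c₃ * |t| ^ 3) (hw'q : ∀ x t, |w' x t| ≤ c₂ * t ^ 2) (hκ : 2 * (κ₀ + c₂) ≤ κ)
    (hτ : 0 < τ) (hθ0 : 0 < θ) (hθ1 : θ < 1) (hκθ : κ * (1 + τ) * γop ≤ θ) (S : Finset V) (ψ₀ : EuclideanSpace ℝ ι)
    (hψ : ∀ p ∈ S, ∑ x ∈ cell p, ψ₀ x ^ 2 ≤ Ψ ^ 2) {p₀ : V} (hp₀ : p₀ ∈ S) {y : ι} (hy : y ∈ cell p₀)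
    (hsmall : Real.exp 1 * (((max (exp (v * (c₃ * h ^ 3 + c₂ * h ^ 2)) - 1) (2 * exp (-((κ / 2 - (κ₀ + c₂)) * h ^ 2)))) *
      exp (κ * (1 + τ⁻¹) * Ψ ^ 2 / 2)) * ((1 - θ) ^ (-(κ * (1 + τ) * γ / (2 * θ)))) ^ v) * ((Δ : ℝ) + 1) ^ 2 ≤ 1 / 2) :
    |(∫ ω : EuclideanSpace ℝ ι, exp (-(∑ p ∈ S, ∑ x ∈ cell p, w x (ω x + ψ₀ x))) * w' y (ω y + ψ₀ y) ∂(multivariateGaussian 0 Γ)) /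
        (∫ ω : EuclideanSpace ℝ ι, exp (-(∑ p ∈ S, ∑ x ∈ cell p, w x (ω x + ψ₀ x))) ∂(multivariateGaussian 0 Γ))| ≤
      2 * ((1 : ℝ) * ((Δ : ℝ) + 1) * (2 * (Real.exp 1 * (((max (exp (v * (c₃ * h ^ 3 + c₂ * h ^ 2)) - 1)
        (2 * exp (-((κ / 2 - (κ₀ + c₂)) * h ^ 2)))) * exp (κ * (1 + τ⁻¹) * Ψ ^ 2 / 2)) * ((1 - θ) ^ (-(κ * (1 + τ) * γ / (2 * θ)))) ^ v)))) := by
  set μ := multivariateGaussian 0 Γ with hμ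
  -- integrability of the three exponentials: road integrands with the remainders `w`, `w ∓ 1_yw'` (stable with `κ₀ + c₂`)
  have hκ₀c : 0 ≤ κ₀ + c₂ := by linarith
  have hκθ₀ : 2 * (κ₀ + c₂) * (1 + τ) * γop ≤ θ := by
    have := mul_opBound_le_of_le (a := 2 * (κ₀ + c₂) * (1 + τ)) (b := κ * (1 + τ)) (by positivity)
      (mul_le_mul_of_nonneg_right hκ (by linarith)) hθ0.le (by simpa [mul_assoc] using hκθ)
    simpa [mul_assoc] using this
  have hstab1 : ∀ r : ℝ, |r| ≤ 1 → ∀ x, ∀ t : ℝ, -((κ₀ + c₂) * t ^ 2) ≤ w x t - r * (if x = y then w' x t else 0) := fun r hr x t => by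
    have h1 := oneSite_stable w w' y r hstab hw'q x t
    have h2 : 0 ≤ c₂ * (1 - |r|) * t ^ 2 := mul_nonneg (mul_nonneg hc₂ (by linarith)) (sq_nonneg t)
    nlinarith
  have hint : ∀ r : ℝ, |r| ≤ 1 → Integrable (fun ω : EuclideanSpace ℝ ι => exp (-(∑ p ∈ S, ∑ x ∈ cell p,
      (w x (ω x + ψ₀ x) - r * (if x = y then w' x (ω x + ψ₀ x) else 0))))) μ := by
    intro r hr
    have h := integrable_exp_neg hΓ hΓop (S.biUnion cell) (fun x t => w x t - r * (if x = y then w' x t else 0))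
      (fun x => oneSite_measurable w w' y r hw hw'm x) hκ₀c hτ hθ1 hκθ₀ (hstab1 r hr) (fun x => ψ₀ x)
    refine h.congr (ae_of_all _ fun ω => ?_)
    simp only
    rw [cellSum_eq_sum_biUnion cell hdisj S]
  have hs1 : |(1 : ℝ)| ≤ 1 := by rw [abs_one]
  have hsm1 : |(-1 : ℝ)| ≤ 1 := by rw [abs_neg, abs_one]
  have hs0 : |(0 : ℝ)| ≤ 1 := by rw [abs_zero]; exact zero_le_one
  have hU : Integrable (fun ω : EuclideanSpace ℝ ι => exp (-(∑ p ∈ S, ∑ x ∈ cell p, w x (ω x + ψ₀ x)))) μ := by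
    refine (hint 0 hs0).congr (ae_of_all _ fun ω => ?_)
    simp only [zero_mul, sub_zero]
  -- `V ∓ F` are the exponents of the perturbed families (`s = ±1`)
  have hshift : ∀ r : ℝ, ∀ ω : EuclideanSpace ℝ ι, ∑ p ∈ S, ∑ x ∈ cell p,
      (w x (ω x + ψ₀ x) - r * (if x = y then w' x (ω x + ψ₀ x) else 0)) =
        ∑ p ∈ S, ∑ x ∈ cell p, w x (ω x + ψ₀ x) - r * w' y (ω y + ψ₀ y) :=
    fun r ω => oneSite_cellSum w w' y r cell hdisj S hp₀ hy (fun x => ω x) (fun x => ψ₀ x)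
  have hF : Integrable (fun ω : EuclideanSpace ℝ ι => exp (-(∑ p ∈ S, ∑ x ∈ cell p, w x (ω x + ψ₀ x)) + w' y (ω y + ψ₀ y))) μ := by
    refine (hint 1 hs1).congr (ae_of_all _ fun ω => ?_)
    simp only [hshift]
    congr 1
    ring
  have hF' : Integrable (fun ω : EuclideanSpace ℝ ι => exp (-(∑ p ∈ S, ∑ x ∈ cell p, w x (ω x + ψ₀ x)) - w' y (ω y + ψ₀ y))) μ := by
    refine (hint (-1) hsm1).congr (ae_of_all _ fun ω => ?_)
    simp only [hshift]
    congr 1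
    ring
  have hUF : Integrable (fun ω : EuclideanSpace ℝ ι => exp (-(∑ p ∈ S, ∑ x ∈ cell p, w x (ω x + ψ₀ x))) * w' y (ω y + ψ₀ y)) μ := by
    have hmeas : AEStronglyMeasurable (fun ω : EuclideanSpace ℝ ι =>
        exp (-(∑ p ∈ S, ∑ x ∈ cell p, w x (ω x + ψ₀ x))) * w' y (ω y + ψ₀ y)) μ :=
      ((measurable_exp.comp (measurable_cellSum cell w hw S (fun x => ψ₀ x)).neg).mul
        ((hw'm y).comp ((by fun_prop : Measurable fun ω : EuclideanSpace ℝ ι => ω y).add_const (ψ₀ y)))).aestronglyMeasurable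
    have hdom : Integrable (fun ω : EuclideanSpace ℝ ι => exp (-(∑ p ∈ S, ∑ x ∈ cell p, w x (ω x + ψ₀ x)) + w' y (ω y + ψ₀ y)) +
        exp (-(∑ p ∈ S, ∑ x ∈ cell p, w x (ω x + ψ₀ x)) - w' y (ω y + ψ₀ y))) μ := hF.add hF'
    refine hdom.mono' hmeas (ae_of_all _ fun ω => ?_)
    rw [norm_mul, Real.norm_of_nonneg (exp_pos _).le, Real.norm_eq_abs]
    have hb : |w' y (ω y + ψ₀ y)| ≤ exp (w' y (ω y + ψ₀ y)) + exp (-w' y (ω y + ψ₀ y)) := by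
      rcases le_or_gt 0 (w' y (ω y + ψ₀ y)) with h0 | h0
      · rw [abs_of_nonneg h0]; linarith [add_one_le_exp (w' y (ω y + ψ₀ y)), exp_pos (-w' y (ω y + ψ₀ y))]
      · rw [abs_of_neg h0]; linarith [add_one_le_exp (-w' y (ω y + ψ₀ y)), exp_pos (w' y (ω y + ψ₀ y))]
    calc exp (-(∑ p ∈ S, ∑ x ∈ cell p, w x (ω x + ψ₀ x))) * |w' y (ω y + ψ₀ y)|
        ≤ exp (-(∑ p ∈ S, ∑ x ∈ cell p, w x (ω x + ψ₀ x))) * (exp (w' y (ω y + ψ₀ y)) + exp (-w' y (ω y + ψ₀ y))) :=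
          mul_le_mul_of_nonneg_left hb (exp_pos _).le
      _ = exp (-(∑ p ∈ S, ∑ x ∈ cell p, w x (ω x + ψ₀ x)) + w' y (ω y + ψ₀ y)) +
          exp (-(∑ p ∈ S, ∑ x ∈ cell p, w x (ω x + ψ₀ x)) - w' y (ω y + ψ₀ y)) := by
          rw [mul_add, ← exp_add, ← exp_add, sub_eq_add_neg]
  -- Gibbs, two-sided
  have hG := abs_tilted_mean_le hU hUF hF hF'
  refine hG.trans (max_le ?_ ?_)
  · have h := abs_log_perturbed_sub_le hΓ hΓop hdiag hγ hfr hdisj hv hR hΔ hnbr hw hw'm hκ₀ hc₂ hc₃ hh hstab hcub hw'q hκ hτ hθ0 hθ1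
      hκθ S ψ₀ hψ hy hs1 hsmall
    have heq : ∫ ω : EuclideanSpace ℝ ι, exp (-(∑ p ∈ S, ∑ x ∈ cell p, w x (ω x + ψ₀ x)) + w' y (ω y + ψ₀ y)) ∂μ =
        ∫ ω : EuclideanSpace ℝ ι, exp (-(∑ p ∈ S, ∑ x ∈ cell p,
          (w x (ω x + ψ₀ x) - 1 * (if x = y then w' x (ω x + ψ₀ x) else 0)))) ∂μ :=
      integral_congr_ae (ae_of_all _ fun ω => by simp only [hshift]; congr 1; ring)
    rw [heq]
    exact (le_abs_self _).trans h
  · have h := abs_log_perturbed_sub_le hΓ hΓop hdiag hγ hfr hdisj hv hR hΔ hnbr hw hw'm hκ₀ hc₂ hc₃ hh hstab hcub hw'q hκ hτ hθ0 hθ1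
      hκθ S ψ₀ hψ hy hsm1 hsmall
    have heq : ∫ ω : EuclideanSpace ℝ ι, exp (-(∑ p ∈ S, ∑ x ∈ cell p, w x (ω x + ψ₀ x)) - w' y (ω y + ψ₀ y)) ∂μ =
        ∫ ω : EuclideanSpace ℝ ι, exp (-(∑ p ∈ S, ∑ x ∈ cell p,
          (w x (ω x + ψ₀ x) - (-1) * (if x = y then w' x (ω x + ψ₀ x) else 0)))) ∂μ :=
      integral_congr_ae (ae_of_all _ fun ω => by simp only [hshift]; congr 1; ring)
    rw [heq]
    exact (le_abs_self _).trans h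

/-- **THE END — THE GRADIENT OF THE SMALL-FIELD EFFECTIVE ACTION IS `O(ε)` PER SITE, UNIFORMLY IN THE VOLUME.**  Under the hypotheses of
`abs_tilted_mean_deriv_le`, with `w ∈ C¹` (`HasDerivAt (w x) (w' x t) t`), the linear bound `|w'_x(t)| ≤ κ₁|t|` (`κ₁ ≥ 0`) and `0 < c₂`:
`|D(−log ∫e^{−Σ_{p∈S}Σ_{x∈cell p}w_x(ω_x+ψ_x)}dN(0,Γ))(ψ₀)(e_y)| ≤ 2·(Δ+1)·2e·ε̃_ΨA_τ^v` — the `y`-partial derivative of the next potential is small,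
for every site `y` of the region and every base point `ψ₀` small on the cells of `S`. [folklore] -/
theorem abs_fderiv_neg_log_step_single_le (hΓ : Γ.PosSemidef) (hΓop : (γop • (1 : Matrix ι ι ℝ) - Γ).PosSemidef)
    (hdiag : ∀ i, Γ i i ≤ γ) (hγ : 0 ≤ γ) (hfr : HasFiniteRange dι ρ Γ) (hdisj : ∀ p q, p ≠ q → Disjoint (cell p) (cell q))
    (hv : ∀ p, (cell p).card ≤ v) (hR : ∀ (p p' : V) (x y : ι), x ∈ cell p → y ∈ cell p' → dι x y ≤ ρ → p = p' ∨ R p p')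
    (hΔ : ∀ x, (nbr x).card ≤ Δ) (hnbr : ∀ x y, R x y → y ∈ nbr x) (hw' : ∀ x t, HasDerivAt (w x) (w' x t) t)
    (hw'm : ∀ x, Measurable (w' x)) (hκ₀ : 0 ≤ κ₀) (hκ₁ : 0 ≤ κ₁) (hc₂ : 0 < c₂) (hc₃ : 0 ≤ c₃) (hh : 0 ≤ h)
    (hstab : ∀ x, ∀ t : ℝ, -(κ₀ * t ^ 2) ≤ w x t) (hcub : ∀ x, ∀ t : ℝ, |t| ≤ h → |w x t| ≤ c₃ * |t| ^ 3)
    (hw'b : ∀ x t, |w' x t| ≤ κ₁ * |t|) (hw'q : ∀ x t, |w' x t| ≤ c₂ * t ^ 2) (hκ : 2 * (κ₀ + c₂) ≤ κ) (hτ : 0 < τ)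
    (hθ0 : 0 < θ) (hθ1 : θ < 1) (hκθ : κ * (1 + τ) * γop ≤ θ) (S : Finset V) (ψ₀ : EuclideanSpace ℝ ι)
    (hψ : ∀ p ∈ S, ∑ x ∈ cell p, ψ₀ x ^ 2 ≤ Ψ ^ 2) {p₀ : V} (hp₀ : p₀ ∈ S) {y : ι} (hy : y ∈ cell p₀)
    (hsmall : Real.exp 1 * (((max (exp (v * (c₃ * h ^ 3 + c₂ * h ^ 2)) - 1) (2 * exp (-((κ / 2 - (κ₀ + c₂)) * h ^ 2)))) *
      exp (κ * (1 + τ⁻¹) * Ψ ^ 2 / 2)) * ((1 - θ) ^ (-(κ * (1 + τ) * γ / (2 * θ)))) ^ v) * ((Δ : ℝ) + 1) ^ 2 ≤ 1 / 2) :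
    |fderiv ℝ (fun ψ : EuclideanSpace ℝ ι =>
        -log (∫ ω : EuclideanSpace ℝ ι, exp (-(∑ p ∈ S, ∑ x ∈ cell p, w x (ω x + ψ x))) ∂(multivariateGaussian 0 Γ))) ψ₀
        (EuclideanSpace.single y (1 : ℝ))| ≤
      2 * ((1 : ℝ) * ((Δ : ℝ) + 1) * (2 * (Real.exp 1 * (((max (exp (v * (c₃ * h ^ 3 + c₂ * h ^ 2)) - 1)
        (2 * exp (-((κ / 2 - (κ₀ + c₂)) * h ^ 2)))) * exp (κ * (1 + τ⁻¹) * Ψ ^ 2 / 2)) * ((1 - θ) ^ (-(κ * (1 + τ) * γ / (2 * θ)))) ^ v)))) := by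
  have hw : ∀ x, Measurable (w x) := fun x => (continuous_iff_continuousAt.2 fun t => (hw' x t).continuousAt).measurable
  -- (313)'s regulator hypothesis with `δ = c₂(1+τ)∕2`
  have hδ : 0 < c₂ * (1 + τ) / 2 := by positivity
  have hκθ' : (2 * κ₀ * (1 + τ) + 4 * (c₂ * (1 + τ) / 2)) * γop ≤ θ := by
    have heq : 2 * κ₀ * (1 + τ) + 4 * (c₂ * (1 + τ) / 2) = 2 * (κ₀ + c₂) * (1 + τ) := by ring
    rw [heq]
    have := mul_opBound_le_of_le (a := 2 * (κ₀ + c₂) * (1 + τ)) (b := κ * (1 + τ)) (by positivity)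
      (mul_le_mul_of_nonneg_right hκ (by linarith)) hθ0.le (by simpa [mul_assoc] using hκθ)
    simpa [mul_assoc] using this
  rw [(hasFDerivAt_neg_log_step hΓ hΓop hdisj hw' hw'm hκ₀ hκ₁ hτ hδ hθ0 hθ1 hκθ' hstab hw'b S ψ₀).fderiv,
    fderiv_neg_log_step_apply hΓ hΓop hdisj hw' hw'm hκ₀ hκ₁ hτ hδ hθ1 hκθ' hstab hw'b S ψ₀ (EuclideanSpace.single y (1 : ℝ))]
  simp_rw [single_cellSum hdisj S hp₀ hy]
  rw [inv_mul_eq_div]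
  exact abs_tilted_mean_deriv_le hΓ hΓop hdiag hγ hfr hdisj hv hR hΔ hnbr hw hw'm hκ₀ hc₂.le hc₃ hh hstab hcub hw'q hκ hτ hθ0 hθ1 hκθ S
    ψ₀ hψ hp₀ hy hsmall

end Main

/-! ## §3. Toy -/

/-- Toy (§1): on a one-cell, one-site lattice the `e_y`-directional sum IS the `y`-term. -/
example (w' : Fin 1 → ℝ → ℝ) (ω ψ : EuclideanSpace ℝ (Fin 1)) :
    ∑ p ∈ ({()} : Finset Unit), ∑ x ∈ (fun _ : Unit => (Finset.univ : Finset (Fin 1))) p,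
        w' x (ω x + ψ x) * (EuclideanSpace.single (0 : Fin 1) (1 : ℝ)) x = w' 0 (ω 0 + ψ 0) :=
  single_cellSum (cell := fun _ : Unit => (Finset.univ : Finset (Fin 1))) (fun p q hpq => absurd (Subsingleton.elim p q) hpq) {()}
    (mem_singleton_self ()) (mem_univ 0) ω ψ

end Summit.QuantumFields.BalabanUV.T4Continuum.NE7b.SupEffectiveActionGradientSmall
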